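import Literature.NumberTheory.K2Lit.DoubledLineThetaKernel
import Literature.NumberTheory.Automorphic.Liu2021.ThetaLiftFromLineMajorantsRankTwo
import HarnessLib

/-!
# [Weil1964, n° 41 Lemme 5 ∕ Thm. 6] Theta majorants of the DOUBLED pair `(U(diag d_D), U(⟨a⟩))` of the rank-two recipe —
# the binder `hρ` of [Liu2021, App. B] (tree socket #42R, organ O42.9), discharged with NO sign hypothesis

Topic `NumberTheory/K2Lit`; namespace `Literature.NumberTheory.K2Lit.DoubledLineTheta` (that of ★ `dD`).  THEOREMS ONLY.
The doubled frame `d_D = (t₀, −t₀) ∘ e₂⁻¹ : Fin (n+n) → L` of ★ `DoubledLineThetaKernel` (`t₀ k = d_V (e⁻¹k)₁ · d_W (e⁻¹k)₂`, here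
`e : Fin 2 × Fin 1 ≃ Fin n`, so `n = 2`) has, through EVERY complex embedding `τ`, exactly two negative and two positive (real,
non-zero) entries — whatever the signs of `d_V`, `d_W` — : `re τ(d_D (e₂ (inl k))) = re τ(t₀ k) = − re τ(d_D (e₂ (inr k)))`
(`dD_signs_twoTwo`).  Hence the real pair `U(d_D)_v × U(⟨a⟩)_v` is `U(2,2) × U(1)` at every real place `v`, the profile (J3) of
★ `Weil1964.ArchDualPairThetaMajorantsRankTwo` (★ `LeviKAKInput.junctionTwo`, word ★ `RealUnitaryKAKPair` over the every-rank Cartan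
decomposition ★ `RealUnitaryKAK`), and ★ `Liu2021.hasThetaMajorants_lineThetaKernelDatum_twoTwo` gives

* **`hasThetaMajorants_pairRep_dD`** — `HasThetaMajorants fun p Φ => pairRep L⁺ L c̄ (n+n) 1 e₁ (diagonal d_D) (J_W a)
  (chiSplittingLine L e₁ d_D … (toHeckeCharacter L μ) … (T_W a) … (J_W a) (JW_eq …)) p Φ` for every conjugate-symplectic `μ` and
  every `a ∈ (L⁺)ˣ` — the binder `hρ i` of socket #42R VERBATIM at `μ := λ⁻¹`, `a := a′ i`, with NO hypothesis beyond the
  socket's own binders.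

HONEST LABEL: HC_CM is proved only modulo the 2 remaining named inputs (hLiu418, h413) until rung 0 closes; this module asserts nothing
of print — it re-uses the tree's proof of Weil's Lemme 5 at the doubled frame.

## References
* [Weil1964] A. Weil, Acta Math. 111 (1964), Chap. III n° 41 Lemme 5 p. 194, Thm. 6 (1) p. 193.
* [Liu2021] Y. Liu, Camb. J. Math. 9 (2021) = arXiv:2102.11518, App. B (doubling method for `U(2,2) × U(1)`), App. D §D.1.
* [GelbartRogawski1991] Invent. Math. 105 (1991), §3.1 Prop. 3.1.1 p. 455.  [Knapp2002] Thm 7.39.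
-/

set_option autoImplicit false

noncomputable section

open NumberField NumberField.InfinitePlace MeasureTheory IsDedekindDomain
open scoped Matrix ComplexOrder

namespace Literature.NumberTheory.K2Lit.DoubledLineTheta

open Literature.NumberTheory.Automorphic Literature.NumberTheory.Automorphic.UnitaryGroup
open Literature.NumberTheory.Automorphic.IdeleClassGroup
open Literature.NumberTheory.Automorphic.Liu2021
open Literature.NumberTheory.Automorphic.Liu2021.Def411WeilCarriers
open Literature.NumberTheory.Automorphic.Liu2021.Def411WeilCarriersDoubling
open Literature.NumberTheory.GelbartRogawski1991 Literature.NumberTheory.GelbartRogawski1991.UnitaryDualPair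
open Literature.NumberTheory.GelbartRogawski1991.GRConstruction
open Literature.NumberTheory.Weil1964
open Literature.RepresentationTheory.Liu2021

variable (L : Type) [Field L] [NumberField L] [IsCMField L]
variable {n : ℕ} (e : Fin 2 × Fin 1 ≃ Fin n)
  (dV : Fin 2 → L) (hdV : ∀ i, IsCMField.complexConj L (dV i) = dV i) (hdV0 : ∀ i, dV i ≠ 0)
  (dW : Fin 1 → L) (hdW : ∀ i, IsCMField.complexConj L (dW i) = dW i) (hdW0 : ∀ i, dW i ≠ 0)

/-! ## 1. The signs of the doubled frame through a complex embedding -/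

/-- `d_D (e₂ (inl k)) = t₀ k`. [cite: GelbartRogawski1991, §3.1 Prop. 3.1.1 p. 455] -/
theorem dD_finSumFinEquiv_inl (k : Fin n) :
    dD L e dV hdV dW hdW (finSumFinEquiv (Sum.inl k)) = (cmGramEntry L e dV hdV dW hdW k : L) := by
  unfold dD
  rw [Equiv.symm_apply_apply, Sum.elim_inl]

/-- `d_D (e₂ (inr k)) = −t₀ k`. [cite: GelbartRogawski1991, §3.1 Prop. 3.1.1 p. 455] -/
theorem dD_finSumFinEquiv_inr (k : Fin n) :
    dD L e dV hdV dW hdW (finSumFinEquiv (Sum.inr k)) = -(cmGramEntry L e dV hdV dW hdW k : L) := by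
  unfold dD
  rw [Equiv.symm_apply_apply, Sum.elim_inr, Pi.neg_apply, NegMemClass.coe_neg]

include hdV0 hdW0 in
/-- the (real) number `re τ(t₀ k)` is non-zero when no `d_V i`, `d_W j` vanishes. [cite: GelbartRogawski1991, §3.1 Prop. 3.1.1 p. 455] -/
theorem re_apply_cmGramEntry_ne_zero (τ : L →+* ℂ) (k : Fin n) :
    (τ (cmGramEntry L e dV hdV dW hdW k : L)).re ≠ 0 :=
  re_apply_ne_zero_of_complexConj_eq L τ
    ((IsCMField.complexConj_eq_self_iff (K := L) _).2 (Subtype.coe_prop _))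
    fun h => cmGramEntry_ne_zero L e dV hdV dW hdW hdV0 hdW0 k (Subtype.ext h)

omit [NumberField L] [IsCMField L] in
/-- every index of the doubled frame is `e₂ (inl k)` or `e₂ (inr k)` with `k ∈ {e (0,0), e (1,0)}`. [folklore] -/
private theorem exists_eq_finSumFinEquiv (i : Fin (n + n)) :
    ∃ k : Fin n, (k = e (0, 0) ∨ k = e (1, 0)) ∧
      (i = finSumFinEquiv (Sum.inl k) ∨ i = finSumFinEquiv (Sum.inr k)) := by
  have hk : ∀ k : Fin n, k = e (0, 0) ∨ k = e (1, 0) := fun k => by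
    obtain ⟨⟨a, b⟩, rfl⟩ := e.surjective k
    obtain rfl : b = 0 := Subsingleton.elim _ _
    fin_cases a
    · exact Or.inl rfl
    · exact Or.inr rfl
  obtain ⟨s, rfl⟩ := finSumFinEquiv.surjective i
  rcases s with k | k
  · exact ⟨k, hk k, Or.inl rfl⟩
  · exact ⟨k, hk k, Or.inr rfl⟩

omit [NumberField L] [IsCMField L] in
/-- `e (0,0) ≠ e (1,0)`. [folklore] -/
private theorem e_zero_ne_e_one : e (0, 0) ≠ e (1, 0) := fun h => by
  have := e.injective h
  simp at this

include hdV0 hdW0 in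
/-- **the doubled frame has signature `(2,2)` through every complex embedding**: two negative entries `i₀ ≠ i₁`, two positive
entries `j₀ ≠ j₁`, every other entry positive (there is none: `n = 2`) — the hypothesis `h22` of
★ `Liu2021.hasThetaMajorants_lineThetaKernelDatum_twoTwo` for `d_V := d_D`. [cite: GelbartRogawski1991, §3.1 Prop. 3.1.1 p. 455] -/
theorem dD_signs_twoTwo (τ : L →+* ℂ) :
    ∃ i₀ i₁ j₀ j₁ : Fin (n + n), i₀ ≠ i₁ ∧ j₀ ≠ j₁ ∧
      (τ (dD L e dV hdV dW hdW i₀)).re < 0 ∧ (τ (dD L e dV hdV dW hdW i₁)).re < 0 ∧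
      0 < (τ (dD L e dV hdV dW hdW j₀)).re ∧ 0 < (τ (dD L e dV hdV dW hdW j₁)).re ∧
      ∀ i, i ≠ i₀ → i ≠ i₁ → 0 < (τ (dD L e dV hdV dW hdW i)).re := by
  -- the two base indices and the signs of `re τ(t₀ k₀)`, `re τ(t₀ k₁)`
  have hk01 := e_zero_ne_e_one e
  have hP : ∀ k, (τ (dD L e dV hdV dW hdW (finSumFinEquiv (Sum.inl k)))).re =
      (τ (cmGramEntry L e dV hdV dW hdW k : L)).re := fun k => by rw [dD_finSumFinEquiv_inl]
  have hM : ∀ k, (τ (dD L e dV hdV dW hdW (finSumFinEquiv (Sum.inr k)))).re =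
      -(τ (cmGramEntry L e dV hdV dW hdW k : L)).re := fun k => by rw [dD_finSumFinEquiv_inr, map_neg, Complex.neg_re]
  have hne : ∀ k k' : Fin n, k ≠ k' → ∀ (s s' : Fin n ⊕ Fin n), (s = Sum.inl k ∨ s = Sum.inr k) → (s' = Sum.inl k' ∨ s' = Sum.inr k') →
      (finSumFinEquiv s : Fin (n + n)) ≠ finSumFinEquiv s' := by
    rintro k k' hkk s s' (rfl | rfl) (rfl | rfl) h <;>
      have h' := finSumFinEquiv.injective h <;> simp_all
  have hPM : ∀ k : Fin n, (finSumFinEquiv (Sum.inl k) : Fin (n + n)) ≠ finSumFinEquiv (Sum.inr k) := fun k h => by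
    have h' := finSumFinEquiv.injective h; simp at h'
  -- the sign pattern at `k`: one of `e₂ (inl k)`, `e₂ (inr k)` is negative, the other positive
  have hpair : ∀ k : Fin n, ∃ s s' : Fin n ⊕ Fin n, (s = Sum.inl k ∨ s = Sum.inr k) ∧ (s' = Sum.inl k ∨ s' = Sum.inr k) ∧ s ≠ s' ∧
      (τ (dD L e dV hdV dW hdW (finSumFinEquiv s))).re < 0 ∧ 0 < (τ (dD L e dV hdV dW hdW (finSumFinEquiv s'))).re ∧
      ∀ s'', (s'' = Sum.inl k ∨ s'' = Sum.inr k) → s'' ≠ s → 0 < (τ (dD L e dV hdV dW hdW (finSumFinEquiv s''))).re := by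
    intro k
    rcases lt_or_gt_of_ne (re_apply_cmGramEntry_ne_zero L e dV hdV hdV0 dW hdW hdW0 τ k) with hk | hk
    · refine ⟨Sum.inl k, Sum.inr k, Or.inl rfl, Or.inr rfl, Sum.inl_ne_inr, by rw [hP]; exact hk,
        by rw [hM]; exact neg_pos.2 hk, ?_⟩
      rintro s'' (rfl | rfl) hs
      · exact absurd rfl hs
      · rw [hM]; exact neg_pos.2 hk
    · refine ⟨Sum.inr k, Sum.inl k, Or.inr rfl, Or.inl rfl, Sum.inr_ne_inl, by rw [hM]; exact neg_lt_zero.2 hk,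
        by rw [hP]; exact hk, ?_⟩
      rintro s'' (rfl | rfl) hs
      · rw [hP]; exact hk
      · exact absurd rfl hs
  obtain ⟨s₀, s₀', hs₀, hs₀', -, hneg₀, hpos₀, hrest₀⟩ := hpair (e (0, 0))
  obtain ⟨s₁, s₁', hs₁, hs₁', -, hneg₁, hpos₁, hrest₁⟩ := hpair (e (1, 0))
  refine ⟨finSumFinEquiv s₀, finSumFinEquiv s₁, finSumFinEquiv s₀', finSumFinEquiv s₁',
    hne _ _ hk01 s₀ s₁ hs₀ hs₁, hne _ _ hk01 s₀' s₁' hs₀' hs₁', hneg₀, hneg₁, hpos₀, hpos₁, fun i hi₀ hi₁ => ?_⟩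
  obtain ⟨k, hk | hk, hi | hi⟩ := exists_eq_finSumFinEquiv e i <;> subst hk <;> subst hi
  · exact hrest₀ _ (Or.inl rfl) fun h => hi₀ (by rw [h])
  · exact hrest₀ _ (Or.inr rfl) fun h => hi₀ (by rw [h])
  · exact hrest₁ _ (Or.inl rfl) fun h => hi₁ (by rw [h])
  · exact hrest₁ _ (Or.inr rfl) fun h => hi₁ (by rw [h])

/-! ## 2. The binder `hρ` of the doubled pair -/

set_option maxHeartbeats 1600000 in
/-- **THE BINDER `hρ i` OF SOCKET #42R ([Liu2021, App. B], organ O42.9), DISCHARGED** — Weil's theta majorants for the doubled pair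
`(U(diagonal d_D), U(⟨a⟩))` at the line's `χ`-splitting for `χ := toHeckeCharacter L μ`, `μ` conjugate-symplectic, `a ∈ (L⁺)ˣ`
arbitrary: NO sign hypothesis (the doubled frame is `U(2,2)` at every real place, `dD_signs_twoTwo`).  For #42R take `μ := λ⁻¹`,
`hμ := IsConjugateSymplectic.inv hλ`, `a := a′ i`. [cite: Weil1964, Chap. III n° 41 Lemme 5 p. 194, Thm. 6 (1) p. 193]
[cite: Liu2021, App. D §D.1 Steps 1–2 (l. 5215–5219)] [cite: GelbartRogawski1991, §3.1 Prop. 3.1.1 p. 455] -/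
theorem hasThetaMajorants_pairRep_dD {n'' : ℕ} (e₁ : Fin (n + n) × Fin 1 ≃ Fin n'')
    (μ : Literature.NumberTheory.Automorphic.IdeleClassGroup L →ₜ* Circle) (hμ : IsConjugateSymplectic L μ)
    (a : (↥(maximalRealSubfield L))ˣ) :
    HasThetaMajorants fun
      (p : ↥(UnitaryGroup.adelic (↥(maximalRealSubfield L)) L (IsCMField.complexConj L) (n + n)
          (Matrix.diagonal (dD L e dV hdV dW hdW))) ×
        ↥(UnitaryGroup.adelic (↥(maximalRealSubfield L)) L (IsCMField.complexConj L) 1 (JW (↥(maximalRealSubfield L)) L a)))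
      (Φ : piSchwartzBruhat (↥(maximalRealSubfield L)) (Fin n'')) =>
        pairRep (↥(maximalRealSubfield L)) L (IsCMField.complexConj L) (n + n) 1 e₁ (Matrix.diagonal (dD L e dV hdV dW hdW))
          (JW (↥(maximalRealSubfield L)) L a)
          (chiSplittingLine L e₁ (dD L e dV hdV dW hdW) (dD_conj L e dV hdV dW hdW) (dD_ne_zero L e dV hdV dW hdW hdV0 hdW0)
            (toHeckeCharacter L μ) (isUnitary_toHeckeCharacter L μ) ((isOscillatorChar_toHeckeCharacter_iff μ).mpr hμ)
            (TW (↥(maximalRealSubfield L)) a) (isUnit_det_TW (↥(maximalRealSubfield L)) a) (JW (↥(maximalRealSubfield L)) L a)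
            (JW_eq (↥(maximalRealSubfield L)) L a)) p Φ :=
  hasThetaMajorants_lineThetaKernelDatum_twoTwo L e₁ (dD L e dV hdV dW hdW) (dD_conj L e dV hdV dW hdW)
    (dD_ne_zero L e dV hdV dW hdW hdV0 hdW0) μ hμ a (dD_signs_twoTwo L e dV hdV hdV0 dW hdW hdW0)

end Literature.NumberTheory.K2Lit.DoubledLineTheta

end
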